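import Literature.Analysis.FluidPDE.PlanarGateTemplate
import Literature.Analysis.FluidPDE.PlanarJunctionAgreement2
import HarnessLib

/-!
# Gate template, second layer: the gate facts and the generator-move package of a second-layer phase

Topic `Literature/Analysis/FluidPDE`. The gate test of `PlanarGateTemplate.lean` (`PhaseQ.gateOKB`)
inspects the stub RUN nodes at the gate faces and the avoidance of the face strips by every other
box. For a second-layer phase `P : PhaseQ2` it is read on the material view `P.toPhase` (a stub node
must be a first-layer run; boxes and steps are the same), and the three gate facts — vanishing on the
face strips away from the windows, the template fields on the windows, tangency on the faces — follow
for the ASSEMBLED fields of `P` exactly as in the first layer (the only element entering is the stub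
run). Together with the interior facts of `PlanarJunctionAgreement2.lean` this gives the
generator-move package `PhaseQ2.isGeneratorMoveOn_of_checks2`.

Folklore; no named facts. Infrastructure towards a discharge of `acm_compatible_blocks`
(`QuasiSelfSimilarCompatibleBlocks.lean`).

## References

* G. Alberti, G. Crippa, A. L. Mazzucato, *Exponential self-similar mixing by incompressible
  flows*, J. Amer. Math. Soc. 32 (2019), 445–490, §7 (arXiv:1605.02090).
-/

noncomputable section

open Function Set Filter
open scoped Topology ContDiff

namespace Literature.Analysis.FluidPDE

namespace PlanarKinematics

open Gluing QuasiSelfSimilar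

/-- The plane `ℝ²` as a Euclidean space. [folklore] -/
local notation "E²" => EuclideanSpace ℝ (Fin 2)

namespace PhaseQ2

variable {P : PhaseQ2} {C : GateC} {stub : Fin 2 → Bool → Option ℕ} {a : ℚ}

/-- **Off the boxes on the face strips** (read on the material view: same boxes). [folklore] -/
theorem not_mem_supp_of_gateOKB2 (h : P.toPhase.gateOKB C stub a = true) (t : ℝ) {z : E²} {k : Fin 2} {s : Bool}
    (hz : |z k - faceValue s| < C.δ) (hw : stub k s = none ∨ (C.δ : ℝ) ≤ |z (GateC.oth k) - 1 / 2|) :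
    ∀ j < P.K, z ∉ ((P.node j).box.frzAt (clock P.T0 P.Tau t)).supp := by
  intro j hj
  have h' := PhaseQ.not_mem_supp_of_gateOKB h t hz hw j (by simpa using hj)
  simpa using h'

/-- **Vanishing on the face strips** away from the gate windows (all times). [folklore] -/
theorem vanish_of_gateOKB2 (hwf : P.chain.WFBd P.Band) (h : P.toPhase.gateOKB C stub a = true) (G : ℝ → ℝ) (t : ℝ) {z : E²}
    {k : Fin 2} {s : Bool} (hz : |z k - faceValue s| < C.δ)
    (hw : ¬ PhaseQ.gateOf stub k s = true ∨ ∃ j, j ≠ k ∧ (C.δ : ℝ) ≤ |z j - 2⁻¹|) :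
    P.velocity t z = 0 ∧ P.scalar G t z = 0 := by
  have hw' : stub k s = none ∨ (C.δ : ℝ) ≤ |z (GateC.oth k) - 1 / 2| := by
    rcases hw with hw | ⟨j, hjk, hj⟩
    · left; simpa [PhaseQ.gateOf] using hw
    · right; rw [GateC.eq_oth_of_ne hjk] at hj; simpa [one_div] using hj
  have hoff := not_mem_supp_of_gateOKB2 h t hz hw'
  have hoff' : ∀ j < P.geoPhase.K, z ∉ ((P.geoPhase.node j).box.frzAt (clock P.geoPhase.T0 P.geoPhase.Tau t)).supp := by
    intro j hj; simpa using hoff j (by simpa using hj)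
  exact ⟨hwf.velocity_eq_zero_off_boxes hoff', hwf.scalar_eq_zero_off_boxes hoff'⟩

/-- **The template fields on the gate windows** (times after the slot start). [folklore] -/
theorem eq_gate_of_gateOKB2 (hwf : P.chain.WFBd P.Band) (hv : P.elemsValidB = true) (h : P.toPhase.gateOKB C stub a = true)
    (G : ℝ → ℝ) {t : ℝ} (ht : (a : ℝ) ≤ t) {z : E²} {k : Fin 2} {s : Bool} {n : ℕ} (hst : stub k s = some n)
    (hz : |z k - faceValue s| < C.δ) (hzw : |z (GateC.oth k) - 1 / 2| < 2 * C.δ) :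
    P.scalar G t z = C.ΘgT G k t (z - faceMidpoint k s) ∧ P.velocity t z = C.VgT k t (z - faceMidpoint k s) := by
  have hf := PhaseQ.gateFaceB_of_gateOKB h k s
  have hC := PhaseQ.validC_of_gateOKB h
  rw [PhaseQ.gateFaceB, hst] at hf
  simp only [Bool.and_eq_true, decide_eq_true_eq, List.all_eq_true, Bool.or_eq_true, Bool.not_eq_true',
    decide_eq_false_iff_not, toPhase_K, toPhase_node, NodeQ2.toNode_box, NodeQ2.toNode_step] at hf
  obtain ⟨⟨⟨⟨⟨hn, hall⟩, hbox⟩, hnode⟩, hout⟩, hin⟩ := hf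
  -- the stub run (a first-layer run)
  rw [PhaseQ.stubNodeB] at hnode
  simp only [toPhase_node, NodeQ2.toNode_e] at hnode
  obtain ⟨r, he⟩ : ∃ r : RunQ, (P.node n).e = .base (.run r) := by
    cases he : (P.node n).e with
    | base b =>
      cases b with
      | run r => exact ⟨r, rfl⟩
      | dg d => rw [he] at hnode; simp [ElemQ2.toElemQ] at hnode
    | sdg s' => rw [he] at hnode; simp [ElemQ2.toElemQ] at hnode
  rw [he] at hnode
  simp only [ElemQ2.toElemQ_base, Bool.and_eq_true] at hnode
  obtain ⟨⟨hfr, hgp⟩, hsc⟩ := hnode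
  have hvr : r.validB = true := by have := validB_node hv hn; rw [he] at this; exact this
  have hT : C.TimeOK (r.sqB C P.t₀ P.τ) t := RunQ.timeOK_of_schedB hsc hC ht
  -- the cut-offs on the window, at any time (the chain is that of the proxy: same boxes and steps)
  have hK : P.geoPhase.K = P.K := by simp
  have hχ0 : ∀ (t' : ℝ) (w : E²), w ∈ PhaseQ.window C.δ k s → ∀ j < P.chain.K, j ≠ n → P.chain.chi j t' w = 0 := by
    intro t' w hw j hj hjn
    have hj' : j < P.K := by simpa using hj
    rcases hall j (List.mem_range.2 hj') with hjn' | hav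
    · exact absurd hjn' hjn
    · refine hwf.chi_eq_zero_of_not_mem hj fun hmem => ?_
      refine BoxQ.not_strip_of_avoidStripB hav (clock_mem_Icc P.T0 P.Tau t') ?_ hw.1
      have eB : P.chain.box j = (P.node j).box.moving P.T0 P.Tau := by
        show P.geoPhase.chain.box j = _; rw [PhaseQ.chain_box, geoPhase_node]; rfl
      rw [eB, BoxQ.moving_frz] at hmem
      exact hmem
  have hχn : ∀ (t' : ℝ) (w : E²), w ∈ PhaseQ.window C.δ k s → P.chain.chi n t' w = C.pT (w (GateC.oth k) - 1 / 2) := by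
    intro t' w hw
    rw [MovingChain.chi_apply, ChainData.chi_apply, MovingChain.frozen_B]
    have eB : P.chain.box n = (P.node n).box.moving P.T0 P.Tau := by
      show P.geoPhase.chain.box n = _; rw [PhaseQ.chain_box, geoPhase_node]; rfl
    rw [eB, BoxQ.moving_frz, BoxQ.val_of_stubBoxB hbox hC (clock_mem_Icc _ _ _) hw.1]
    have eJ : ∀ m, (P.chain.frozen t').J m = (P.node m).step.toJ P.T0 P.Tau := fun m => by
      show (P.geoPhase.chain.frozen t').J m = _; rw [MovingChain.frozen_J, PhaseQ.chain_J, geoPhase_node]; rfl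
    have eK : (P.chain.frozen t').K = P.K := by show (P.geoPhase.chain.frozen t').K = _; simp
    have hin1 : (P.chain.frozen t').sigmaIn n t' w = 1 := by
      rw [ChainData.sigmaIn]
      split_ifs with h0
      · rfl
      · rcases hin with h0' | hin
        · exact absurd h0' h0
        · rw [ChainData.sigmaOut, if_pos (by rw [eK]; omega), eJ]
          exact JStep.val_eq_one _ (StepQ.le_arg_of_inStepB hin _ _ _ hw.1 hw.2)
    have hout0 : (P.chain.frozen t').sigmaOut n t' w = 0 := by
      rw [ChainData.sigmaOut]
      split_ifs with h1
      · rcases hout with h1' | hout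
        · exact absurd (by rw [eK] at h1; simpa using h1) h1'
        · rw [eJ]; exact JStep.val_eq_zero _ (StepQ.arg_le_of_outStepB hout _ _ _ hw.1 hw.2)
      · rfl
    rw [hin1, hout0, sub_zero, mul_one]
  -- the element fields on the face strip at the time `t` (the stub run)
  have hel : ∀ w : E², |w k - faceValue s| < C.δ →
      P.Θ G n t w = G ((w (GateC.oth k) - 1 / 2) / C.Wt t) ∧ P.H n t w = C.ΨT k t (w - faceMidpoint k s) := by
    intro w hw
    have := RunQ.stub_fields hvr hfr hgp hsc hC G hT hw
    simp only [PhaseQ2.Θ, PhaseQ2.H, he, ElemQ2.scalar_base, ElemQ2.stream_base, ElemQ.scalar, ElemQ.stream,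
      PhaseQ2.T0, PhaseQ2.Tau]
    exact this
  have hzW : z ∈ PhaseQ.window C.δ k s := ⟨hz, hzw⟩
  have hnK : n < P.chain.K := by simpa using hn
  constructor
  · -- scalar
    rw [PhaseQ2.scalar, (assembled_single (H := P.H) hnK (hχ0 t z hzW)).1, hχn t z hzW, (hel z hz).1, GateC.ΘgT_eq,
      PhaseQ.sub_faceMidpoint_oth]
  · -- velocity
    have hev : ∀ᶠ p in 𝓝 (t, z), ∀ j < P.chain.K, j ≠ n → P.chain.chi j p.1 p.2 = 0 :=
      eventually_of_mem_open (U := {p : ℝ × E² | p.2 ∈ PhaseQ.window C.δ k s})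
        (P := fun t' w => ∀ j < P.chain.K, j ≠ n → P.chain.chi j t' w = 0)
        ((PhaseQ.isOpen_window _ k s).preimage continuous_snd)
        (show (t, z) ∈ {p : ℝ × E² | p.2 ∈ PhaseQ.window (C.δ : ℝ) k s} from hzW) fun p hp => hχ0 p.1 p.2 hp
    rw [PhaseQ2.velocity, assembledVelocity_single hnK hev]
    have hloc : (fun w => P.chain.chi n t w * P.H n t w) =ᶠ[𝓝 z] fun w => C.HgT k t (w - faceMidpoint k s) := by
      filter_upwards [(PhaseQ.isOpen_window (C.δ : ℝ) k s).mem_nhds hzW] with w hw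
      rw [hχn t w hw, (hel w hw.1).2, GateC.HgT_eq, PhaseQ.sub_faceMidpoint_oth]
    rw [perpGrad_congr hloc, perpGrad_comp_sub, GateC.VgT_eq_perpGrad]

/-- **Tangency on the faces** (times after the slot start). [folklore] -/
theorem tangent_of_gateOKB2 (hwf : P.chain.WFBd P.Band) (hv : P.elemsValidB = true) (h : P.toPhase.gateOKB C stub a = true)
    {t : ℝ} (ht : (a : ℝ) ≤ t) (z : E²) (j : Fin 2) (hj : z j = 0 ∨ z j = 1) : P.velocity t z j = 0 := by
  have hC := PhaseQ.validC_of_gateOKB h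
  have hδ := GateC.δ_pos hC
  obtain ⟨s, hs⟩ : ∃ s : Bool, z j = faceValue s := by
    rcases hj with hj | hj
    exacts [⟨false, by simp [hj]⟩, ⟨true, by simp [hj]⟩]
  have hz : |z j - faceValue s| < C.δ := by rw [hs, sub_self, abs_zero]; exact hδ
  by_cases hcase : PhaseQ.gateOf stub j s = true ∧ |z (GateC.oth j) - 1 / 2| < C.δ
  · obtain ⟨hg, hw⟩ := hcase
    obtain ⟨n, hst⟩ := Option.isSome_iff_exists.1 hg
    have hw2 : |z (GateC.oth j) - 1 / 2| < 2 * C.δ := by linarith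
    rw [(eq_gate_of_gateOKB2 hwf hv h (fun _ => 0) ht hst hz hw2).2]
    exact GateC.VgT_tangent j t (by rw [PhaseQ.sub_faceMidpoint_self, hs, sub_self])
  · have hw : ¬ PhaseQ.gateOf stub j s = true ∨ ∃ i, i ≠ j ∧ (C.δ : ℝ) ≤ |z i - 2⁻¹| := by
      by_cases hg : PhaseQ.gateOf stub j s = true
      · right
        refine ⟨GateC.oth j, GateC.oth_ne j, ?_⟩
        have : ¬ |z (GateC.oth j) - 1 / 2| < C.δ := fun hw => hcase ⟨hg, hw⟩
        simpa [one_div] using not_lt.1 this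
      · exact Or.inl hg
    rw [(vanish_of_gateOKB2 hwf h (fun _ => 0) t hz hw).1]
    rfl

/-- The clock window is positive for a phase whose proxy passes the geometric check. [folklore] -/
theorem τ_pos_of_geomB2 (hg : P.geoPhase.geomB = true) : 0 < P.τ := by
  have h := PhaseQ.Tau_pos (PhaseQ.elemsValidB_of_geomB hg)
  have h' : (0 : ℝ) < (P.τ : ℝ) := h
  exact_mod_cast h'

/-- **A checked second-layer phase is a generator move on its slot.** [folklore] -/
theorem isGeneratorMoveOn_of_checks2 {G : ℝ → ℝ} (hG : ContDiff ℝ ∞ G) (hM : ∀ q, |G q| ≤ 10)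
    (hG0 : ∀ q, G q ≠ 0 → |q| < P.r₀) (hGe : ∀ x, G (-x) = G x) (hv : P.elemsValidB = true)
    (hg : P.geoPhase.geomB = true) (hsep : P.geoPhase.boxSepB = true) (ha : P.agreeB2 = true)
    (hgate : P.toPhase.gateOKB C stub a = true) :
    IsGeneratorMoveOn (Ici (a : ℝ)) P.velocity (P.scalar G) (PhaseQ.gateOf stub) C.VgT (C.ΘgT G) C.δ := by
  have hw : P.chain.WFBd P.Band := PhaseQ.wfbd_of_geomB hg hsep
  have h10 : (0 : ℝ) ≤ 10 := by norm_num
  have hsq : ∀ z : E², z ∈ closedSquare → ∀ j, 0 ≤ z j ∧ z j ≤ 1 := fun z hz j => hz j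
  exact
    { smooth_velocity := P.contDiff_uncurry_velocity hG hM h10 hG0 hv hw
      smooth_scalar := P.contDiff_uncurry_scalar hG hM h10 hG0 hv hw
      divFree := fun t _ z _ => P.divergence_velocity hG hM h10 hG0 hv hw t z
      tangent := fun t ht z _ j hj => tangent_of_gateOKB2 hw hv hgate ht z j hj
      transport := fun t _ z hz => transport_of_checks2 hG hM h10 hG0 hGe hv hg hsep ha t (hsq z hz)
      abs_le := fun t _ z hz => abs_scalar_le_of_checks2 hG hM h10 hG0 hGe hv hg hsep ha t (hsq z hz)
      vanish := fun t _ z k s hz hws => vanish_of_gateOKB2 hw hgate G t hz hws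
      eq_gate := fun t ht z k s hgs hz hzw => by
        obtain ⟨n, hst⟩ := Option.isSome_iff_exists.1 hgs
        have hzw' : |z (GateC.oth k) - 1 / 2| < 2 * C.δ := by simpa [one_div] using hzw (GateC.oth k) (GateC.oth_ne k)
        have e := eq_gate_of_gateOKB2 hw hv hgate G ht hst hz hzw'
        exact ⟨e.2, e.1⟩ }

end PhaseQ2

end PlanarKinematics

end Literature.Analysis.FluidPDE
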